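import Literature.Analysis.Calculus.NestedJetsWithin
import Literature.MathematicalPhysics.QuantumFieldTheory.Balaban1983to89.B1Eq363JetProof

/-!
# `Balaban1983to89.B1Eq363JetWithin` — T. Bałaban, *(Higgs)₂,₃ quantum fields in a finite volume. I. A lower bound*,
Commun. Math. Phys. **85** (1982) 603–626 [Balaban1982Higgs1]: the step **(3.62) ⇒ (3.63)**, p. 624 — *"Because we
take here an expansion until the order n̄ only, so in (3.61) we can take a whole function E_k instead of its expansion
until the order n̄"* — PROVED as the
`n̄`-JET STATEMENT it is, in the **ONE-SIDED reading of record** (r12's `B1Sect3Statements.pertSum362R`, v1.1: the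
`λ′`-derivatives of the perturbative sums (3.36)/(3.62) taken FROM THE RIGHT at `λ′ = 0⁺`, because the generating
functions (3.35) exist only for `λ′ ≥ 0` — p. 605 *"We will assume that μ₀² > 0 and λ > 0"*): every hypothesis of
p14's two-sided `B1Eq363JetProof.eq362_363` is replaced by its within-form on the closed half-plane `ℝ × [0, ∞)`, so
that generating functions which are finite (and smooth) only for `λ′ ≥ 0` — e.g. the concrete `E_k` of the typer's
`B1Eq335GeneratingFunction` — can meet them.

statement-level skeleton of published theorems with citation tags; proofs where landed; nothing here is a claim about the Yang–Mills mass gap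

PDF held: `paper:balaban1982-cmp85-higgs23-i` (journal page = PDF page + 602); p. 624 read on the x2 render
`run/shared/lean/pub/pub-balaban/b2b-balaban-ref1/pages/1982-cmp85-higgs23-I/…-p022-x2.png`, p. 605 (the regime
`λ > 0`) `…-p003-x2.png`, (3.35)/(3.36) p. 618 `…-p016-x2.png`.

CITATION HEADER (lean-in-tree rule).  WHAT IS REPRODUCED — SKELETON row **B1.Eq3.62–3.63** of reader r12
(`lit-balaban-r12/ROWS-B1-part2.md`; head word of the lead 2026-08-24T15:54Z via r14's PROXY v8: `proved p247024 ·
p244846 · p247253 · p332088 · p370451 · p239973`, SCOPE *"n̄-jet substitution `eq362_363` with print's tacit regularity as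
DISPLAYED hypotheses"*; this file is the zero-head-weight FREE TARGET the lead's word 15:56Z welcomed: *"the one-sided
(λ′ ≥ 0) variant … would let the row's SCOPE drop the two-sided-smoothness clause"*).  Verbatim, p. 624 [PDF 22]:
*"Analyzing carefully the successive steps we get the following perturbative formula S^{(k+1),L^{k+1}ε}(B, ψ) =
Σ_{0≦α+β≦n̄} (1/(α!β!)) e^αλ^β (∂^{α+β}/∂e′^α∂λ′^β E(e′, λ′, B, ψ))|_{e′=λ′=0}. (3.62)  Because we take here an expansion
until the order n̄ only, so in (3.61) we can take a whole function E_k instead of its expansion until the order n̄. Hence we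
have S^{(k+1),L^{k+1}ε}(B, ψ) = Σ_{0≦α+β≦n̄} (1/(α!β!)) e^αλ^β (∂^{α+β}/∂e′^α∂λ′^β E′(e′, λ′, B, ψ))|_{e′=λ′=0}, (3.63) where E′ is
an expression given by the formula (3.61) only instead of the Taylor expansion of the function E_k in the exponent we have
the function E_k(e′, λ′, eB^{(k+1)ε} + e′A′^{(k)ε}, φ) itself"* (render p022-x2 re-read this gen); the caveat eight lines above
(3.62): *"More exactly the formula is not well defined because the expression in the exponent is a high order polynomial in
the fields φ, A_k, which is not necessarily positive … It is not interesting enough to make these remarks more precise"*;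
p. 605 (render p003-x2): *"We will assume that μ₀² > 0 and λ > 0, and these assumptions are basic for this paper"*.

THE MATHEMATICS (as in p14's `B1Eq363JetProof`, whose module docstring is the reference; here only what changes).  With
`K(u, s, t) = E_k(s, t, eB^{(k+1)ε} + uA′^{(k)ε}, φ)` at fixed fields, the exponent of (3.61) in the one-sided reading is
`F(e′, λ′) = pertSum362R (K e′) e′ λ′ n̄ = Σ_{α+β≦n̄} (1/(α!β!)) e′^αλ′^β ∂^α_s∂^β_{t,[0,∞)}K(e′, 0, 0⁺)` and the whole
function is `G(e′, λ′) = K(e′, e′, λ′)`.  The ONE-SIDED nested `n̄`-jet at `(0, 0⁺)` — the coefficients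
`∂^a_{e′}[∂^b_{λ′,[0,∞)}(·)(e′, 0⁺)](0)`, `a + b ≦ n̄`, exactly what `pertSum362R` sees — of `F` and of `G` agree:
(A) `F(e′, ·)` is a polynomial, so its right derivative at `0⁺` is the ordinary one and equals
`Σ_{α≦n̄−b} e′^α/α! ∂^α_s N_b(e′, 0)` with `N_b(u, s) = ∂^b_{t,[0,∞)}K(u, s, 0⁺)` JOINTLY SMOOTH ON `ℝ²` (two-sided in
`(u, s)`: `NestedJetWithin.contDiff_uncurry_iteratedDerivWithin_slice₂`), while `∂^b_{λ′,[0,∞)}G(e′, 0⁺) = N_b(e′, e′)`;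
p14's two-sided diagonal Taylor lemma `NestedJet.iteratedDeriv_diag_eq_taylorSum` applied to `N_b` closes (A)
(`jet_taylor_diag_within`); (B) equal one-sided nested jets pass through `exp(−·)`, the product with the kernel, the
two integrals (GIVEN differentiation under them, one-sided in `λ′`) and `½⟨B,ΔB⟩ − log(·)` away from `0`
(`NestedJetWithin.comp`/`.mul`: Faà di Bruno / Leibniz WITHIN `[0, ∞)`); (C) hence the two one-sided perturbative sums
agree (`eq362_363R`), i.e. (3.62) ⇒ (3.63) in the reading of record (`eq363R_of_eq362R`).

THE TYPING: as `B1Eq363JetProof` (`V`, `X`, `Y`, `(ΩA, νA)`, kernel `t₁ e′ a`, `Ek e′ a φ : ℝ → ℝ → ℝ`, `nbar`, `quadB`),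
with `B1RT.rtOp` (2.4) and r12's `pertSum362R`; the generating function of (3.61) in the one-sided reading is written
out (`½quadB − log ∫ T_{t₁(e′,a)}[φ ↦ exp(−pertSum362R (E_k(·,·; e′,a,φ)) e′ λ′ n̄)](ψ) dνA(a)`; p14's `genFn361` is the
same with the two-sided `pertSum362` in the exponent).

WHAT THIS FILE PROVES (theorems only, 0 definitions, 0 `Prop` facts, 0 `sorry`, standard axioms):
* `iteratedDerivWithin_pertSum362R_snd` — the `b`-th RIGHT `λ′`-derivative at `0⁺` of `λ′ ↦ pertSum362R E e λ′ n̄` is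
  `Σ_{α≦n̄−b} e^α/α! · ∂^α_{e′}[∂^b_{λ′,[0,∞)}E(e′, 0⁺)](0)` (`b ≦ n̄`);
* `contDiff_pertSum362R` — the one-sided exponent of (3.61) is jointly `C^∞` in `(e′, λ′)` on `ℝ²` when `K` is `C^∞`
  WITHIN `{t ≥ 0}`;
* **`jet_taylor_diag_within`** — (A);  `pertSum362R_congr_jet` — `pertSum362R` sees only the one-sided nested `n̄`-jet;
* `integrand_jet_eq` — (B) pointwise in `(a, φ)`;
* **`eq362_363R`** — (C), under the displayed one-sided hypotheses (a)–(d) below;  `eq363R_of_eq362R` — the printed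
  implication for r12's one-sided `Eq336R`-shaped action formula.
HONEST SCOPE.  Hypotheses of `eq362_363R`, all displayed and all ONE-SIDED (they constrain nothing at `λ′ < 0`):
(a) `(u, s, t) ↦ E_k(s, t, eB + uA′, φ)` of class `C^∞` WITHIN `{t ≥ 0}` (`ContDiffOn … (univ ×ˢ Set.Ici 0)`) for
every `(a, φ)`; (b) the kernel smooth in `e′`; (c) the two `dνA`-integrals `C^∞` WITHIN `ℝ × [0, ∞)` and non-zero
there (the author's caveat, p. 624 — no convergence is proved here); (d) for `a + b ≦ n̄` the nested one-sided
derivative `∂^a_{e′}[∂^b_{λ′,[0,∞)}(·)(e′,0⁺)](0)` of each integral equals the `∫dνA ∫dφ` integral of that of its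
integrand.  Which `E_k` of the papers meets (a)–(d) is established elsewhere; nothing here asserts (3.26) or any bound.
Unit `lit-balaban-typer` gen 32 (literature-prover-lit-balaban-typer-g32-0), free target under the cell's G.5-34(d);
HOME `run/shared/lean/pub/lit-balaban/` (FILED.md records the proposal); one-sided calculus in
`Literature/Analysis/Calculus/NestedJetsWithin.lean` (same seat), two-sided in p14's `NestedJets.lean` (reused BY NAME).
-/

open scoped ContDiff BigOperators
open _root_.MeasureTheory Finset

namespace Literature.MathematicalPhysics.QuantumFieldTheory.Balaban1983to89.B1Eq363JetWithin

open Literature.MathematicalPhysics.QuantumFieldTheory.Balaban1983to89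
open Literature.Analysis.Calculus
open B1RT B1Sect3Statements

/-- `n ≤ ∞` for a natural number `n` (exponent bookkeeping). [folklore] -/
private theorem natCast_le_infty (n : ℕ) : (n : ℕ∞ω) ≤ ∞ := mod_cast le_top

/-- Derivatives at `0` of a monomial `λ′ ↦ A·λ′^β·B`. [folklore] -/
private theorem iteratedDeriv_monomial (A B : ℝ) (β b : ℕ) :
    iteratedDeriv b (fun l : ℝ => A * l ^ β * B) 0 = if b = β then A * B * (β.factorial : ℝ) else 0 := by
  have h : (fun l : ℝ => A * l ^ β * B) = fun l => (A * B) * l ^ β := by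
    funext l
    ring
  rw [h, iteratedDeriv_const_mul_field, iteratedDeriv_fun_pow_zero]
  split_ifs <;> ring

/-- `0 ∈ [0, ∞)`. [folklore] -/
private theorem zero_mem_Ici : (0 : ℝ) ∈ Set.Ici (0 : ℝ) := Set.mem_Ici.mpr le_rfl

/-! ## §1 The right `λ′`-derivatives of the one-sided perturbative sum (3.62), and its smoothness in the couplings -/

section StepOne

/-- **The right `λ′`-derivatives of (3.62) at zero coupling, one-sided reading.**  `λ′ ↦ pertSum362R E e λ′ n̄` is a
polynomial, so its `b`-th derivative WITHIN `[0, ∞)` at `0` is the ordinary one, `= Σ_{α≦n̄−b} e^α/α! ·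
∂^α_{e′}[∂^b_{λ′,[0,∞)}E(e′, 0⁺)](0)` for `b ≦ n̄` (only the monomials `λ′^b` survive; cf. p14's two-sided
`B1Eq363JetProof.iteratedDeriv_pertSum362_snd`). [cite: Balaban1982Higgs1, (3.62) p.624] -/
theorem iteratedDerivWithin_pertSum362R_snd (E : ℝ → ℝ → ℝ) (e : ℝ) {nbar b : ℕ} (hb : b ≤ nbar) :
    iteratedDerivWithin b (fun l => pertSum362R E e l nbar) (Set.Ici 0) 0
      = ∑ α ∈ range (nbar - b + 1), e ^ α / (α.factorial : ℝ)
          * iteratedDeriv α (fun e' => iteratedDerivWithin b (fun l' => E e' l') (Set.Ici 0) 0) 0 := by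
  have hpoly : ContDiff ℝ ∞ (fun l : ℝ => pertSum362R E e l nbar) := by
    unfold pertSum362R
    exact ContDiff.sum fun ab _ => (contDiff_const.mul (contDiff_id.pow _)).mul contDiff_const
  rw [iteratedDerivWithin_eq_iteratedDeriv (uniqueDiffOn_Ici 0) (hpoly.contDiffAt.of_le (natCast_le_infty b))
    zero_mem_Ici]
  unfold pertSum362R
  rw [iteratedDeriv_fun_sum fun ab _ => by
    exact ((contDiff_const.mul (contDiff_id.pow _)).mul contDiff_const).contDiffAt]
  simp_rw [iteratedDeriv_monomial]
  rw [sum_filter, sum_product]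
  have hinner : ∀ α ∈ range (nbar + 1),
      (∑ β ∈ range (nbar + 1), if α + β ≤ nbar then
        (if b = β then 1 / ((α.factorial : ℝ) * (β.factorial : ℝ)) * e ^ α
          * iteratedDeriv α (fun e' => iteratedDerivWithin β (fun l' => E e' l') (Set.Ici 0) 0) 0
            * (β.factorial : ℝ)
          else 0) else 0)
      = if α + b ≤ nbar then e ^ α / (α.factorial : ℝ)
          * iteratedDeriv α (fun e' => iteratedDerivWithin b (fun l' => E e' l') (Set.Ici 0) 0) 0 else 0 := by
    intro α _
    have hswap : ∀ β ∈ range (nbar + 1), (if α + β ≤ nbar then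
        (if b = β then 1 / ((α.factorial : ℝ) * (β.factorial : ℝ)) * e ^ α
          * iteratedDeriv α (fun e' => iteratedDerivWithin β (fun l' => E e' l') (Set.Ici 0) 0) 0
            * (β.factorial : ℝ)
          else 0) else 0)
        = if b = β then (if α + β ≤ nbar then e ^ α / (α.factorial : ℝ)
          * iteratedDeriv α (fun e' => iteratedDerivWithin β (fun l' => E e' l') (Set.Ici 0) 0) 0 else 0)
          else 0 := by
      intro β _
      have hβ : (β.factorial : ℝ) ≠ 0 := by positivity
      have hα : (α.factorial : ℝ) ≠ 0 := by positivity
      split_ifs <;> first | rfl | field_simp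
    rw [sum_congr rfl hswap, sum_ite_eq]
    simp [Nat.lt_succ_of_le hb]
  rw [sum_congr rfl hinner, ← sum_filter]
  congr 1
  ext α
  simp only [mem_filter, mem_range]
  omega

/-- **The one-sided exponent of (3.61) is jointly smooth in the couplings**: for `K(u, s, t)` of class `C^∞` WITHIN
`{t ≥ 0}` (`K` ↤ `(u, s, t) ↦ E_k(s, t, eB^{(k+1)ε} + uA′^{(k)ε}, φ)` at fixed fields),
`(e′, λ′) ↦ Σ_{α+β≦n̄} (1/(α!β!)) e′^αλ′^β ∂^α_s∂^β_{t,[0,∞)}K(e′, 0, 0⁺)` is `C^∞` on `ℝ²` (a polynomial in `(e′, λ′)` is not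
meant: the coefficients depend on `e′`; they are `∂^α_s N_β(e′, 0)` with `N_β(u, s) = ∂^β_{t,[0,∞)}K(u, s, 0⁺)` jointly
smooth, `NestedJetWithin.contDiff_uncurry_iteratedDerivWithin_slice₂` + `NestedJet.contDiff_iteratedDeriv_snd_comp`).
[cite: Balaban1982Higgs1, (3.61)–(3.62) pp.623–624] -/
theorem contDiff_pertSum362R (K : ℝ → ℝ → ℝ → ℝ)
    (hK : ContDiffOn ℝ ∞ (fun p : (ℝ × ℝ) × ℝ => K p.1.1 p.1.2 p.2) (Set.univ ×ˢ Set.Ici 0)) (nbar : ℕ) :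
    ContDiff ℝ ∞ (Function.uncurry fun u t => pertSum362R (K u) u t nbar) := by
  unfold pertSum362R
  refine ContDiff.sum fun ab _ => ?_
  refine ((contDiff_const.mul (contDiff_fst.pow _)).mul (contDiff_snd.pow _)).mul ?_
  have hN : ContDiff ℝ ∞ (Function.uncurry fun u s => iteratedDerivWithin ab.2 (K u s) (Set.Ici 0) 0) :=
    NestedJetWithin.contDiff_uncurry_iteratedDerivWithin_slice₂ (uniqueDiffOn_Ici 0) hK zero_mem_Ici ab.2
  exact (NestedJet.contDiff_iteratedDeriv_snd_comp hN ab.1 contDiff_const).comp contDiff_fst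

end StepOne

/-! ## §2 (A) The one-sided jet identity: the expansion of `E_k` and the whole `E_k` have the same nested `n̄`-jet -/

section JetIdentity

/-- **(A), one-sided — "we can take a whole function E_k instead of its expansion until the order n̄".**  For
`K(u, s, t)` of class `C^∞` WITHIN `{t ≥ 0}`, the one-sided exponent of (3.61), `F(u, t′) = pertSum362R (K u) u t′ n̄`, and
the whole function on the diagonal, `G(u, t′) = K(u, u, t′)`, have the same ONE-SIDED nested coefficients
`∂^a_u[∂^b_{t′,[0,∞)}(·)(u, 0⁺)](0)` for all `a + b ≦ n̄`.  Proof: the right `t′`-derivative of the polynomial `F(u, ·)`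
(`iteratedDerivWithin_pertSum362R_snd`) leaves `Σ_{α≦n̄−b} u^α/α! ∂^α_s N_b(u, 0)` with `N_b(u, s) = ∂^b_{t,[0,∞)}K(u, s, 0⁺)`
JOINTLY SMOOTH ON `ℝ²`, and `∂^b_{t′,[0,∞)}G(u, 0⁺) = N_b(u, u)`; then p14's two-sided Taylor formula in `s` along the
diagonal (`NestedJet.iteratedDeriv_diag_eq_taylorSum`). [cite: Balaban1982Higgs1, (3.62)–(3.63) p.624] -/
theorem jet_taylor_diag_within (K : ℝ → ℝ → ℝ → ℝ)
    (hK : ContDiffOn ℝ ∞ (fun p : (ℝ × ℝ) × ℝ => K p.1.1 p.1.2 p.2) (Set.univ ×ˢ Set.Ici 0)) (nbar : ℕ) {a b : ℕ}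
    (hab : a + b ≤ nbar) :
    iteratedDeriv a (fun u => iteratedDerivWithin b (fun t => pertSum362R (K u) u t nbar) (Set.Ici 0) 0) 0
      = iteratedDeriv a (fun u => iteratedDerivWithin b (fun t => K u u t) (Set.Ici 0) 0) 0 := by
  have hN : ContDiff ℝ ∞ (Function.uncurry fun u s => iteratedDerivWithin b (K u s) (Set.Ici 0) 0) :=
    NestedJetWithin.contDiff_uncurry_iteratedDerivWithin_slice₂ (uniqueDiffOn_Ici 0) hK zero_mem_Ici b
  have h1 : (fun u => iteratedDerivWithin b (fun t => pertSum362R (K u) u t nbar) (Set.Ici 0) 0)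
      = fun u => ∑ α ∈ range (nbar - b + 1), u ^ α / (α.factorial : ℝ)
          * iteratedDeriv α (fun s => iteratedDerivWithin b (K u s) (Set.Ici 0) 0) 0 := by
    funext u
    exact iteratedDerivWithin_pertSum362R_snd (K u) u (by omega)
  rw [h1]
  exact (NestedJet.iteratedDeriv_diag_eq_taylorSum hN (a := a) (M := nbar - b + 1) (by omega)).symm

/-- **The one-sided perturbative sum (3.62) only sees the one-sided nested `n̄`-jet**: generating functions with the
same `∂^a_{e′}[∂^b_{λ′,[0,∞)}(·)(e′,0⁺)](0)`, `a + b ≦ n̄`, have the same `pertSum362R`. [cite: Balaban1982Higgs1, (3.62) p.624] -/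
theorem pertSum362R_congr_jet {E₁ E₂ : ℝ → ℝ → ℝ} {nbar : ℕ}
    (h : ∀ a b, a + b ≤ nbar →
      iteratedDeriv a (fun u => iteratedDerivWithin b (fun s => E₁ u s) (Set.Ici 0) 0) 0
        = iteratedDeriv a (fun u => iteratedDerivWithin b (fun s => E₂ u s) (Set.Ici 0) 0) 0) (e lam : ℝ) :
    pertSum362R E₁ e lam nbar = pertSum362R E₂ e lam nbar := by
  unfold pertSum362R
  refine sum_congr rfl fun ab hab => ?_
  rw [h ab.1 ab.2 (by simpa using (mem_filter.mp hab).2)]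

end JetIdentity

/-! ## §3 (B)–(C) Through `exp`, the kernel, the two integrals and `−log`, one-sidedly: (3.62) = (3.63) -/

section Assembly

/-- **(B), one-sided, pointwise in the fluctuation configuration `a` and the fine field `φ`**: the integrands of the
(2.4)-integral `T_{t₁}[·]` in (3.61) (one-sided exponent) and in (3.63) — the kernel value times `exp(−F)`, resp.
`exp(−G)` — have the same one-sided nested coefficients `∂^a_{e′}[∂^b_{λ′,[0,∞)}(·)(e′,0⁺)](0)` for `a + b ≦ n̄`
(from `jet_taylor_diag_within` through `x ↦ exp(−x)` and the product with the `e′`-dependent kernel,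
`NestedJetWithin.comp`/`NestedJetWithin.mul`). [cite: Balaban1982Higgs1, (3.62)–(3.63) p.624] -/
theorem integrand_jet_eq {ΩA Φ : Type*} (t : ℝ → ΩA → Φ → ℝ) (Ek : ℝ → ΩA → Φ → ℝ → ℝ → ℝ) (nbar : ℕ)
    (a' : ΩA) (φ : Φ)
    (hK : ContDiffOn ℝ ∞ (fun p : (ℝ × ℝ) × ℝ => Ek p.1.1 a' φ p.1.2 p.2) (Set.univ ×ˢ Set.Ici 0))
    (ht : ContDiff ℝ ∞ (fun e' => t e' a' φ)) :
    ∀ a b, a + b ≤ nbar →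
      iteratedDeriv a (fun e' => iteratedDerivWithin b (fun l' =>
          t e' a' φ * Real.exp (-pertSum362R (Ek e' a' φ) e' l' nbar)) (Set.Ici 0) 0) 0
        = iteratedDeriv a (fun e' => iteratedDerivWithin b (fun l' =>
          t e' a' φ * Real.exp (-Ek e' a' φ e' l')) (Set.Ici 0) 0) 0 := by
  have hI : UniqueDiffOn ℝ (Set.Ici (0 : ℝ)) := uniqueDiffOn_Ici 0
  have hF : ContDiffOn ℝ ∞ (Function.uncurry fun u l => pertSum362R (Ek u a' φ) u l nbar)
      (Set.univ ×ˢ Set.Ici 0) :=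
    (contDiff_pertSum362R (fun u s l => Ek u a' φ s l) hK nbar).contDiffOn
  have hG : ContDiffOn ℝ ∞ (Function.uncurry fun u l => Ek u a' φ u l) (Set.univ ×ˢ Set.Ici 0) := by
    have hmap : ContDiff ℝ ∞ (fun p : ℝ × ℝ => ((p.1, p.1), p.2)) :=
      (contDiff_fst.prodMk contDiff_fst).prodMk contDiff_snd
    exact hK.comp hmap.contDiffOn fun p hp => ⟨Set.mem_univ _, hp.2⟩
  have hJ : ∀ a b, a + b ≤ nbar →
      iteratedDeriv a (fun u => iteratedDerivWithin b (fun l => pertSum362R (Ek u a' φ) u l nbar) (Set.Ici 0) 0) 0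
        = iteratedDeriv a (fun u => iteratedDerivWithin b (fun l => Ek u a' φ u l) (Set.Ici 0) 0) 0 :=
    fun a b hab => jet_taylor_diag_within (fun u s l => Ek u a' φ s l) hK nbar hab
  have hexp : ContDiffOn ℝ ∞ (fun x : ℝ => Real.exp (-x)) Set.univ :=
    (Real.contDiff_exp.comp contDiff_neg).contDiffOn
  have h2 := NestedJetWithin.comp hI zero_mem_Ici isOpen_univ hexp hF hG (fun _ _ _ => Set.mem_univ _)
    (fun _ _ _ => Set.mem_univ _) hJ
  have hH : ContDiffOn ℝ ∞ (Function.uncurry fun (u : ℝ) (_ : ℝ) => t u a' φ) (Set.univ ×ˢ Set.Ici 0) :=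
    (ht.comp contDiff_fst).contDiffOn
  have hF' : ContDiffOn ℝ ∞ (Function.uncurry fun u l => Real.exp (-pertSum362R (Ek u a' φ) u l nbar))
      (Set.univ ×ˢ Set.Ici 0) :=
    Real.contDiff_exp.comp_contDiffOn hF.neg
  have hG' : ContDiffOn ℝ ∞ (Function.uncurry fun u l => Real.exp (-Ek u a' φ u l)) (Set.univ ×ˢ Set.Ici 0) :=
    Real.contDiff_exp.comp_contDiffOn hG.neg
  exact NestedJetWithin.mul hI zero_mem_Ici hH hF' hG' h2

variable {V : Type*} [NormedAddCommGroup V] [InnerProductSpace ℝ V] [FiniteDimensional ℝ V]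
  [MeasurableSpace V] [BorelSpace V]
variable {X Y : Type*} [Fintype X]
variable {ΩA : Type*} [MeasurableSpace ΩA]

/-- **(3.62) = (3.63), p. 624, ONE-SIDED reading of record** — *"in (3.61) we can take a whole function E_k instead of
its expansion until the order n̄"*.  With `E(e′,λ′) = ½quadB − log ∫ T_{t₁(e′,a)}[φ ↦ exp(−pertSum362R (E_k(·,·; e′,a,φ))
e′ λ′ n̄)](ψ) dνA(a)` ((3.61) with the ONE-SIDED Taylor polynomial of `E_k` in the exponent) and `E′(e′,λ′) = ½quadB −
log ∫ T_{t₁(e′,a)}[φ ↦ exp(−E_k(e′,λ′; e′,a,φ))](ψ) dνA(a)` (the whole `E_k`):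
`pertSum362R E e λ n̄ = pertSum362R E′ e λ n̄`, PROVIDED (a) `hK`: `(u, s, t) ↦ E_k(s, t; u, a, φ)` is `C^∞` WITHIN
`{t ≥ 0}` for every `(a, φ)`; (b) `ht`: the kernel is `C^∞` in the coupling; (c) `hI₁, hI₂, hne₁, hne₂`: the two
`dνA`-integrals are `C^∞` WITHIN `ℝ × [0, ∞)` and non-zero there; (d) `hD₁, hD₂`: for `a + b ≦ n̄`, the one-sided nested
derivative `∂^a_{e′}[∂^b_{λ′,[0,∞)}(·)(e′,0⁺)](0)` of each integral is the `∫dνA ∫dφ` integral of that of its integrand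
(`B1RT.rtOp t ρ ψ = ∫ t ψ φ · ρ φ dφ`).  Nothing is assumed at `λ′ < 0`. [cite: Balaban1982Higgs1, (3.62)–(3.63) p.624] -/
theorem eq362_363R (quadB : ℝ) (νA : Measure ΩA) (t₁ : ℝ → ΩA → (Y → V) → (X → V) → ℝ)
    (Ek : ℝ → ΩA → (X → V) → ℝ → ℝ → ℝ) (nbar : ℕ) (ψ : Y → V)
    (hK : ∀ a φ, ContDiffOn ℝ ∞ (fun p : (ℝ × ℝ) × ℝ => Ek p.1.1 a φ p.1.2 p.2) (Set.univ ×ˢ Set.Ici 0))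
    (ht : ∀ a φ, ContDiff ℝ ∞ (fun e' => t₁ e' a ψ φ))
    (hI₁ : ContDiffOn ℝ ∞ (Function.uncurry fun e' l' =>
      ∫ a, rtOp (t₁ e' a) (fun φ => Real.exp (-pertSum362R (Ek e' a φ) e' l' nbar)) ψ ∂νA)
      (Set.univ ×ˢ Set.Ici 0))
    (hI₂ : ContDiffOn ℝ ∞ (Function.uncurry fun e' l' =>
      ∫ a, rtOp (t₁ e' a) (fun φ => Real.exp (-Ek e' a φ e' l')) ψ ∂νA) (Set.univ ×ˢ Set.Ici 0))
    (hne₁ : ∀ e' l', 0 ≤ l' →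
      ∫ a, rtOp (t₁ e' a) (fun φ => Real.exp (-pertSum362R (Ek e' a φ) e' l' nbar)) ψ ∂νA ≠ 0)
    (hne₂ : ∀ e' l', 0 ≤ l' → ∫ a, rtOp (t₁ e' a) (fun φ => Real.exp (-Ek e' a φ e' l')) ψ ∂νA ≠ 0)
    (hD₁ : ∀ a b, a + b ≤ nbar →
      iteratedDeriv a (fun e' => iteratedDerivWithin b (fun l' =>
        ∫ a', rtOp (t₁ e' a') (fun φ => Real.exp (-pertSum362R (Ek e' a' φ) e' l' nbar)) ψ ∂νA) (Set.Ici 0) 0) 0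
      = ∫ a', (∫ φ, iteratedDeriv a (fun e' => iteratedDerivWithin b (fun l' =>
          t₁ e' a' ψ φ * Real.exp (-pertSum362R (Ek e' a' φ) e' l' nbar)) (Set.Ici 0) 0) 0) ∂νA)
    (hD₂ : ∀ a b, a + b ≤ nbar →
      iteratedDeriv a (fun e' => iteratedDerivWithin b (fun l' =>
        ∫ a', rtOp (t₁ e' a') (fun φ => Real.exp (-Ek e' a' φ e' l')) ψ ∂νA) (Set.Ici 0) 0) 0
      = ∫ a', (∫ φ, iteratedDeriv a (fun e' => iteratedDerivWithin b (fun l' =>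
          t₁ e' a' ψ φ * Real.exp (-Ek e' a' φ e' l')) (Set.Ici 0) 0) 0) ∂νA)
    (e lam : ℝ) :
    pertSum362R (fun e' l' => 1 / 2 * quadB
        - Real.log (∫ a, rtOp (t₁ e' a) (fun φ => Real.exp (-pertSum362R (Ek e' a φ) e' l' nbar)) ψ ∂νA))
        e lam nbar
      = pertSum362R (fun e' l' => 1 / 2 * quadB
          - Real.log (∫ a, rtOp (t₁ e' a) (fun φ => Real.exp (-Ek e' a φ e' l')) ψ ∂νA)) e lam nbar := by
  apply pertSum362R_congr_jet
  -- the one-sided nested `n̄`-jets of the two `dνA`-integrals agree (hypothesis (d) + the pointwise statement (B))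
  have hI : ∀ a b, a + b ≤ nbar →
      iteratedDeriv a (fun e' => iteratedDerivWithin b (fun l' =>
        ∫ a', rtOp (t₁ e' a') (fun φ => Real.exp (-pertSum362R (Ek e' a' φ) e' l' nbar)) ψ ∂νA) (Set.Ici 0) 0) 0
      = iteratedDeriv a (fun e' => iteratedDerivWithin b (fun l' =>
        ∫ a', rtOp (t₁ e' a') (fun φ => Real.exp (-Ek e' a' φ e' l')) ψ ∂νA) (Set.Ici 0) 0) 0 := by
    intro a b hab
    rw [hD₁ a b hab, hD₂ a b hab]
    congr 1
    funext a'
    congr 1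
    funext φ
    exact integrand_jet_eq (fun e' a' φ => t₁ e' a' ψ φ) Ek nbar a' φ (hK a' φ) (ht a' φ) a b hab
  -- through `x ↦ ½quadB − log x`, smooth away from `0` (hypothesis (c)), within `[0, ∞)` in `λ′`
  have hφ : ContDiffOn ℝ ∞ (fun x : ℝ => 1 / 2 * quadB - Real.log x) {0}ᶜ :=
    contDiffOn_const.sub Real.contDiffOn_log
  have key := NestedJetWithin.comp (uniqueDiffOn_Ici 0) zero_mem_Ici isOpen_compl_singleton hφ hI₁ hI₂
    (fun e' l' hl' => hne₁ e' l' (Set.mem_Ici.mp hl')) (fun e' l' hl' => hne₂ e' l' (Set.mem_Ici.mp hl')) hI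
  intro a b hab
  exact key a b hab

/-- **The printed implication (3.62) ⇒ (3.63), one-sided reading**: under the hypotheses of `eq362_363R`, if the action
is given by the one-sided perturbative formula (3.62) for `E` of (3.61), `S^{(k+1),L^{k+1}ε}(B, ψ) = pertSum362R E e λ n̄`,
then it is given by the same formula for `E′` with the whole `E_k` — *"Hence we have S^{(k+1),L^{k+1}ε}(B, ψ) = Σ … E′ …
(3.63)"* —
the shape consumed by r12's one-sided `Step363R`/`Eq336R` (p332088) and the typer's `B1Eq365Concrete.step363R_concrete`
(p370451). [cite: Balaban1982Higgs1, (3.62)–(3.64) p.624] -/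
theorem eq363R_of_eq362R (quadB : ℝ) (νA : Measure ΩA) (t₁ : ℝ → ΩA → (Y → V) → (X → V) → ℝ)
    (Ek : ℝ → ΩA → (X → V) → ℝ → ℝ → ℝ) (nbar : ℕ) (ψ : Y → V)
    (hK : ∀ a φ, ContDiffOn ℝ ∞ (fun p : (ℝ × ℝ) × ℝ => Ek p.1.1 a φ p.1.2 p.2) (Set.univ ×ˢ Set.Ici 0))
    (ht : ∀ a φ, ContDiff ℝ ∞ (fun e' => t₁ e' a ψ φ))
    (hI₁ : ContDiffOn ℝ ∞ (Function.uncurry fun e' l' =>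
      ∫ a, rtOp (t₁ e' a) (fun φ => Real.exp (-pertSum362R (Ek e' a φ) e' l' nbar)) ψ ∂νA)
      (Set.univ ×ˢ Set.Ici 0))
    (hI₂ : ContDiffOn ℝ ∞ (Function.uncurry fun e' l' =>
      ∫ a, rtOp (t₁ e' a) (fun φ => Real.exp (-Ek e' a φ e' l')) ψ ∂νA) (Set.univ ×ˢ Set.Ici 0))
    (hne₁ : ∀ e' l', 0 ≤ l' →
      ∫ a, rtOp (t₁ e' a) (fun φ => Real.exp (-pertSum362R (Ek e' a φ) e' l' nbar)) ψ ∂νA ≠ 0)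
    (hne₂ : ∀ e' l', 0 ≤ l' → ∫ a, rtOp (t₁ e' a) (fun φ => Real.exp (-Ek e' a φ e' l')) ψ ∂νA ≠ 0)
    (hD₁ : ∀ a b, a + b ≤ nbar →
      iteratedDeriv a (fun e' => iteratedDerivWithin b (fun l' =>
        ∫ a', rtOp (t₁ e' a') (fun φ => Real.exp (-pertSum362R (Ek e' a' φ) e' l' nbar)) ψ ∂νA) (Set.Ici 0) 0) 0
      = ∫ a', (∫ φ, iteratedDeriv a (fun e' => iteratedDerivWithin b (fun l' =>
          t₁ e' a' ψ φ * Real.exp (-pertSum362R (Ek e' a' φ) e' l' nbar)) (Set.Ici 0) 0) 0) ∂νA)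
    (hD₂ : ∀ a b, a + b ≤ nbar →
      iteratedDeriv a (fun e' => iteratedDerivWithin b (fun l' =>
        ∫ a', rtOp (t₁ e' a') (fun φ => Real.exp (-Ek e' a' φ e' l')) ψ ∂νA) (Set.Ici 0) 0) 0
      = ∫ a', (∫ φ, iteratedDeriv a (fun e' => iteratedDerivWithin b (fun l' =>
          t₁ e' a' ψ φ * Real.exp (-Ek e' a' φ e' l')) (Set.Ici 0) 0) 0) ∂νA)
    {S e lam : ℝ}
    (h362 : S = pertSum362R (fun e' l' => 1 / 2 * quadB
        - Real.log (∫ a, rtOp (t₁ e' a) (fun φ => Real.exp (-pertSum362R (Ek e' a φ) e' l' nbar)) ψ ∂νA))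
        e lam nbar) :
    S = pertSum362R (fun e' l' => 1 / 2 * quadB
          - Real.log (∫ a, rtOp (t₁ e' a) (fun φ => Real.exp (-Ek e' a φ e' l')) ψ ∂νA)) e lam nbar := by
  rw [h362]
  exact eq362_363R quadB νA t₁ Ek nbar ψ hK ht hI₁ hI₂ hne₁ hne₂ hD₁ hD₂ e lam

end Assembly

end Literature.MathematicalPhysics.QuantumFieldTheory.Balaban1983to89.B1Eq363JetWithin
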